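import Mathlib
import Summits.RiemannHypothesis.RiemannHypothesis.Theorems.WeilFarFloorShiftFormLipschitz
import HarnessLib

/-!
# The prime-shift operator: `L²` bound, window change, collar, and the coupling transfer to a perturbed profile

Helper file (`--supports stmt-RiemannHypothesis-0098`, lead-track anchor: Weil-positivity window ladder, format-C far bound),
pure proofs, RH-free.  Seat rh-explicit-weil-1 gen12 (memo `run/shared/lean/pub/rh-explicit/rh-explicit-weil-1/FORMAT-K3.md` §13.6):
toolkit for stage 3 of C-XIII″.  `(T_b f)(x) = Σ_{log n < 2b} (Λ(n)/√n)(f(x − log n) + f(x + log n))` is the prime-shift operator of the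
window (`Q_b(cf + r) = c²Q_b(f) + Q_b(r) + 2c∫(T_b f)r`, file `WeilFarFloorFormPolarization`); «admissible on `[−b, b]`» = real, measurable,
bounded, vanishing off `[−b, b]`.
* §1 `integral_primeShiftOp_sq_le` : **`∫ (T_b f)² ≤ 4(Σ_{log n<2b} Λ(n)/√n)²·∫ f²`** (Cauchy–Schwarz over the prime powers).
* §2 WINDOW CHANGE (`b ≤ b'`, `f` vanishing off `[−b, b]`): `T_{b'} f = T_b f` on `(−b, b)` and `Q_{b'}(f) = Q_b(f)`.
* §3 COLLAR: `|T_{b'} f| ≤ 2(Σ Λ/√n)·sup|f|`, `∫_S (T_{b'}f)² ≤ (2(Σ Λ/√n) sup|f|)²·|S|`, `|[−b', b'] \ [−b, b]| ≤ 2(b' − b)`.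
* §4 `abs_setIntegral_mul_le` : `|∫_S F v| ≤ √(∫_S F²)·√(∫ v²)`.
* §5 **COUPLING TRANSFER** `abs_integral_primeShiftOp_mul_le` : `G` admissible on `[−b, b]`, `Gm` admissible on `[−b', b']` (in the
  application a mollification of the cosh profile `G`), `r ⊥ Gm` admissible on `[−b', b']`, `τ` real:
  `|∫ (T_{b'} Gm)·r| ≤ (√(∫_{(−b,b)} (T_b G − τG)²) + (2Σ_{b'}Λ/√n + |τ|)·‖Gm − G‖₂ + 2(Σ_{b'}Λ/√n)·sup|G|·√(2(b'−b)))·‖r‖₂` — the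
  coupling to the perturbed profile is controlled by the coupling defect of the ORIGINAL profile on the open window (cosh profile under
  RH: `WeilFarFloorCoshCouplingRH`), the distance `‖Gm − G‖₂` and the collar.  Standard axioms only.
-/


set_option linter.dupNamespace false
set_option autoImplicit false

noncomputable section

open MeasureTheory Set Filter
open scoped Real Topology ArithmeticFunction.vonMangoldt

namespace Summit.RiemannHypothesis.RiemannHypothesis.Theorems.WeilFormatC

namespace FloorCoshSplit

open Literature.NumberTheory.LFunctions

variable {b b' : ℝ} {f : ℝ → ℝ} {Cf : ℝ}

/-! ## §0 Integrability of admissible products -/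

/-- The product of a measurable bounded `F` with an admissible `v` on `[−B, B]` is integrable. -/
theorem integrable_mul_admissible {F v : ℝ → ℝ} {CF Cv B : ℝ} (hF : Measurable F) (hCF : ∀ x, |F x| ≤ CF)
    (hv : Measurable v) (hCv : ∀ x, |v x| ≤ Cv) (hvs : ∀ x, x ∉ Icc (-B) B → v x = 0) :
    Integrable fun x ↦ F x * v x :=
  (FloorSmoothing.integrable_shift_mul_shift_left hv hF hCv hCF hvs 0 0).congr
    (Eventually.of_forall fun x ↦ by simp only [sub_zero]; ring)

/-- The square of an admissible `v` is integrable. -/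
theorem integrable_sq_admissible {v : ℝ → ℝ} {Cv B : ℝ} (hv : Measurable v) (hCv : ∀ x, |v x| ≤ Cv)
    (hvs : ∀ x, x ∉ Icc (-B) B → v x = 0) : Integrable fun x ↦ v x ^ 2 :=
  (FloorSmoothing.integrable_shift_mul_shift_left hv hv hCv hCv hvs 0 0).congr
    (Eventually.of_forall fun x ↦ by simp only [sub_zero]; ring)

/-! ## §1 `T_b` is bounded on `L²` by the weight sum -/

/-- Pointwise Cauchy–Schwarz over the prime powers:
`(Σ aₙ(f(x−ℓₙ) + f(x+ℓₙ)))² ≤ (Σ aₙ)·Σ aₙ(2f(x−ℓₙ)² + 2f(x+ℓₙ)²)` (`aₙ = Λ(n)/√n ≥ 0`). -/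
theorem primeShiftOp_sq_le (f : ℝ → ℝ) (x : ℝ) :
    (∑ n ∈ weilPrimeIndex b, (Λ n : ℝ) / Real.sqrt n * (f (x - Real.log n) + f (x + Real.log n))) ^ 2
      ≤ (∑ n ∈ weilPrimeIndex b, (Λ n : ℝ) / Real.sqrt n)
        * ∑ n ∈ weilPrimeIndex b, (Λ n : ℝ) / Real.sqrt n * (2 * f (x - Real.log n) ^ 2 + 2 * f (x + Real.log n) ^ 2) := by
  have ha : ∀ n ∈ weilPrimeIndex b, 0 ≤ (Λ n : ℝ) / Real.sqrt n := fun n _ ↦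
    div_nonneg ArithmeticFunction.vonMangoldt_nonneg (Real.sqrt_nonneg _)
  refine (Finset.sum_sq_le_sum_mul_sum_of_sq_le_mul (weilPrimeIndex b) ha (fun n hn ↦ ?_) (fun n hn ↦ ?_))
  · exact mul_nonneg (ha n hn) (by positivity)
  · have h0 := ha n hn
    have hsq : (f (x - Real.log n) + f (x + Real.log n)) ^ 2 ≤ 2 * f (x - Real.log n) ^ 2 + 2 * f (x + Real.log n) ^ 2 := by
      nlinarith only [sq_nonneg (f (x - Real.log n) - f (x + Real.log n))]
    calc ((Λ n : ℝ) / Real.sqrt n * (f (x - Real.log n) + f (x + Real.log n))) ^ 2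
        = (Λ n : ℝ) / Real.sqrt n * ((Λ n : ℝ) / Real.sqrt n * (f (x - Real.log n) + f (x + Real.log n)) ^ 2) := by ring
      _ ≤ (Λ n : ℝ) / Real.sqrt n * ((Λ n : ℝ) / Real.sqrt n * (2 * f (x - Real.log n) ^ 2 + 2 * f (x + Real.log n) ^ 2)) :=
          mul_le_mul_of_nonneg_left (mul_le_mul_of_nonneg_left hsq h0) h0

/-- The Cauchy–Schwarz majorant `x ↦ (Λ(n)/√n)(2f(x − log n)² + 2f(x + log n)²)` is integrable. -/
theorem integrable_weight_mul_sq_shifts (hf : Measurable f) (hCf : ∀ x, |f x| ≤ Cf)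
    (hfs : ∀ x, x ∉ Icc (-b) b → f x = 0) (n : ℕ) :
    Integrable fun x ↦ (Λ n : ℝ) / Real.sqrt n * (2 * f (x - Real.log n) ^ 2 + 2 * f (x + Real.log n) ^ 2) :=
  ((((integrable_sq_admissible hf hCf hfs).comp_sub_right (Real.log n)).const_mul 2).add
    (((integrable_sq_admissible hf hCf hfs).comp_add_right (Real.log n)).const_mul 2)).const_mul _

/-- `T_{b'} f` is measurable for measurable `f`. -/
theorem measurable_primeShiftOp (hf : Measurable f) :
    Measurable fun x ↦ ∑ n ∈ weilPrimeIndex b', (Λ n : ℝ) / Real.sqrt n * (f (x - Real.log n) + f (x + Real.log n)) :=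
  Finset.measurable_sum _ fun _ _ ↦ ((hf.comp (measurable_id.sub_const _)).add
    (hf.comp (measurable_id.add_const _))).const_mul _

/-- `(T_{b'} f)²` is integrable for an admissible `f` (any index window `b'`). -/
theorem integrable_primeShiftOp_sq (hf : Measurable f) (hCf : ∀ x, |f x| ≤ Cf) (hfs : ∀ x, x ∉ Icc (-b) b → f x = 0) :
    Integrable fun x ↦
      (∑ n ∈ weilPrimeIndex b', (Λ n : ℝ) / Real.sqrt n * (f (x - Real.log n) + f (x + Real.log n))) ^ 2 := by
  have hmaj : Integrable fun x ↦ (∑ n ∈ weilPrimeIndex b', (Λ n : ℝ) / Real.sqrt n) * ∑ n ∈ weilPrimeIndex b',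
      (Λ n : ℝ) / Real.sqrt n * (2 * f (x - Real.log n) ^ 2 + 2 * f (x + Real.log n) ^ 2) :=
    (integrable_finsetSum _ fun n _ ↦ integrable_weight_mul_sq_shifts hf hCf hfs n).const_mul _
  refine hmaj.mono' ((measurable_primeShiftOp hf).pow_const 2).aestronglyMeasurable (Eventually.of_forall fun x ↦ ?_)
  rw [Real.norm_eq_abs, abs_of_nonneg (sq_nonneg _)]
  exact primeShiftOp_sq_le f x

/-- **`∫ (T_{b'} f)² ≤ 4(Σ_{log n<2b'} Λ(n)/√n)²·∫f²`**: the prime-shift operator is bounded on `L²` by the weight sum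
`W = Σ 2Λ(n)/√n` (for an admissible `f` on any window `[−b, b]`). -/
theorem integral_primeShiftOp_sq_le (hf : Measurable f) (hCf : ∀ x, |f x| ≤ Cf) (hfs : ∀ x, x ∉ Icc (-b) b → f x = 0) :
    ∫ x, (∑ n ∈ weilPrimeIndex b', (Λ n : ℝ) / Real.sqrt n * (f (x - Real.log n) + f (x + Real.log n))) ^ 2
      ≤ 4 * (∑ n ∈ weilPrimeIndex b', (Λ n : ℝ) / Real.sqrt n) ^ 2 * ∫ x, f x ^ 2 := by
  set A := ∑ n ∈ weilPrimeIndex b', (Λ n : ℝ) / Real.sqrt n with hA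
  have hterm := integrable_weight_mul_sq_shifts (b := b) hf hCf hfs
  have hmaj : Integrable fun x ↦ A * ∑ n ∈ weilPrimeIndex b',
      (Λ n : ℝ) / Real.sqrt n * (2 * f (x - Real.log n) ^ 2 + 2 * f (x + Real.log n) ^ 2) :=
    (integrable_finsetSum _ fun n _ ↦ hterm n).const_mul A
  calc ∫ x, (∑ n ∈ weilPrimeIndex b', (Λ n : ℝ) / Real.sqrt n * (f (x - Real.log n) + f (x + Real.log n))) ^ 2
      ≤ ∫ x, A * ∑ n ∈ weilPrimeIndex b',
          (Λ n : ℝ) / Real.sqrt n * (2 * f (x - Real.log n) ^ 2 + 2 * f (x + Real.log n) ^ 2) :=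
        integral_mono_of_nonneg (Eventually.of_forall fun x ↦ sq_nonneg _) hmaj
          (Eventually.of_forall fun x ↦ primeShiftOp_sq_le f x)
    _ = A * ∑ n ∈ weilPrimeIndex b', (Λ n : ℝ) / Real.sqrt n * (4 * ∫ x, f x ^ 2) := by
        rw [integral_const_mul, integral_finsetSum _ fun n _ ↦ hterm n]
        congr 1
        refine Finset.sum_congr rfl fun n _ ↦ ?_
        have h0 := integrable_sq_admissible hf hCf hfs
        rw [integral_const_mul, integral_add ((h0.comp_sub_right _).const_mul 2) ((h0.comp_add_right _).const_mul 2),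
          integral_const_mul, integral_const_mul, integral_sub_right_eq_self (fun y ↦ f y ^ 2) (Real.log n),
          integral_add_right_eq_self (fun y ↦ f y ^ 2) (Real.log n)]
        ring
    _ = 4 * A ^ 2 * ∫ x, f x ^ 2 := by rw [← Finset.sum_mul]; ring

/-! ## §2 Window change: prime powers with `2b ≤ log n` do not see `[−b, b]` -/

/-- `weilPrimeIndex` is monotone in the half-width. -/
theorem weilPrimeIndex_subset_of_le (hbb : b ≤ b') : weilPrimeIndex b ⊆ weilPrimeIndex b' := fun n hn ↦
  mem_weilPrimeIndex.2 ((mem_weilPrimeIndex.1 hn).trans_le (by linarith))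

/-- **`T_{b'} f = T_b f` on the open window `(−b, b)`** for `f` vanishing off `[−b, b]` and `b ≤ b'`. -/
theorem primeShiftOp_eq_of_le (hfs : ∀ x, x ∉ Icc (-b) b → f x = 0) (hbb : b ≤ b') {x : ℝ} (hx : x ∈ Ioo (-b) b) :
    ∑ n ∈ weilPrimeIndex b', (Λ n : ℝ) / Real.sqrt n * (f (x - Real.log n) + f (x + Real.log n))
      = ∑ n ∈ weilPrimeIndex b, (Λ n : ℝ) / Real.sqrt n * (f (x - Real.log n) + f (x + Real.log n)) := by
  refine (Finset.sum_subset (weilPrimeIndex_subset_of_le hbb) fun n _ hn ↦ ?_).symm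
  have hge : 2 * b ≤ Real.log n := not_lt.1 fun h ↦ hn (mem_weilPrimeIndex.2 h)
  rw [hfs (x - Real.log n) fun hm ↦ by linarith [hm.1, hx.2],
    hfs (x + Real.log n) fun hm ↦ by linarith [hm.2, hx.1], add_zero, mul_zero]

/-- A shift by `ℓ ≥ 2b` decouples `f` from itself: `∫ f(x − ℓ) f(x) dx = 0` for `f` vanishing off `[−b, b]`. -/
theorem integral_shift_mul_eq_zero_of_le (hfs : ∀ x, x ∉ Icc (-b) b → f x = 0) {ℓ : ℝ} (hℓ : 2 * b ≤ ℓ) :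
    ∫ x, f (x - ℓ) * f x = 0 := by
  refine integral_eq_zero_of_ae ?_
  have hae : ({b}ᶜ : Set ℝ) ∈ ae (volume : Measure ℝ) := compl_mem_ae_iff.2 (measure_singleton b)
  filter_upwards [hae] with x hx
  by_cases hxm : x ∈ Icc (-b) b
  · have hlt : x < b := lt_of_le_of_ne hxm.2 fun h ↦ hx (by simp [h])
    simp only [Pi.zero_apply, hfs (x - ℓ) fun hm ↦ by linarith [hm.1], zero_mul]
  · simp only [Pi.zero_apply, hfs x hxm, mul_zero]

/-- **`Q_{b'}(f) = Q_b(f)`** for `f` vanishing off `[−b, b]` and `b ≤ b'`. -/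
theorem primeShiftForm_eq_of_le (hfs : ∀ x, x ∉ Icc (-b) b → f x = 0) (hbb : b ≤ b') :
    primeShiftForm b' f = primeShiftForm b f := by
  unfold primeShiftForm
  refine (Finset.sum_subset (weilPrimeIndex_subset_of_le hbb) fun n _ hn ↦ ?_).symm
  rw [integral_shift_mul_eq_zero_of_le hfs (not_lt.1 fun h ↦ hn (mem_weilPrimeIndex.2 h)), mul_zero]

/-! ## §3 Pointwise bound and the collar -/

/-- `|T_{b'} f(x)| ≤ 2(Σ Λ(n)/√n)·sup|f|` pointwise. -/
theorem abs_primeShiftOp_le (hCf : ∀ x, |f x| ≤ Cf) (x : ℝ) :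
    |∑ n ∈ weilPrimeIndex b', (Λ n : ℝ) / Real.sqrt n * (f (x - Real.log n) + f (x + Real.log n))|
      ≤ 2 * (∑ n ∈ weilPrimeIndex b', (Λ n : ℝ) / Real.sqrt n) * Cf := by
  rw [mul_comm (2 : ℝ), mul_assoc, Finset.sum_mul]
  refine (Finset.abs_sum_le_sum_abs _ _).trans (Finset.sum_le_sum fun n _ ↦ ?_)
  have ha : 0 ≤ (Λ n : ℝ) / Real.sqrt n := div_nonneg ArithmeticFunction.vonMangoldt_nonneg (Real.sqrt_nonneg _)
  rw [abs_mul, abs_of_nonneg ha]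
  refine mul_le_mul_of_nonneg_left ((abs_add_le _ _).trans ?_) ha
  linarith [hCf (x - Real.log n), hCf (x + Real.log n)]

/-- `∫_S (T_{b'} f)² ≤ (2(Σ Λ/√n)·sup|f|)²·|S|` on any set of finite measure. -/
theorem setIntegral_primeShiftOp_sq_le (hCf : ∀ x, |f x| ≤ Cf) {S : Set ℝ} (hSfin : volume S ≠ ⊤) :
    ∫ x in S, (∑ n ∈ weilPrimeIndex b', (Λ n : ℝ) / Real.sqrt n * (f (x - Real.log n) + f (x + Real.log n))) ^ 2
      ≤ (2 * (∑ n ∈ weilPrimeIndex b', (Λ n : ℝ) / Real.sqrt n) * Cf) ^ 2 * volume.real S := by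
  set M := 2 * (∑ n ∈ weilPrimeIndex b', (Λ n : ℝ) / Real.sqrt n) * Cf with hM
  have hpt : ∀ x, (∑ n ∈ weilPrimeIndex b', (Λ n : ℝ) / Real.sqrt n * (f (x - Real.log n) + f (x + Real.log n))) ^ 2
      ≤ M ^ 2 := fun x ↦ by
    have h := abs_le.1 (abs_primeShiftOp_le (b' := b') hCf x)
    exact sq_le_sq' h.1 h.2
  haveI : IsFiniteMeasure (volume.restrict S) := isFiniteMeasure_restrict.2 hSfin
  calc ∫ x in S, (∑ n ∈ weilPrimeIndex b', (Λ n : ℝ) / Real.sqrt n * (f (x - Real.log n) + f (x + Real.log n))) ^ 2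
      ≤ ∫ _ in S, M ^ 2 :=
        integral_mono_of_nonneg (Eventually.of_forall fun x ↦ sq_nonneg _) (integrable_const _)
          (Eventually.of_forall hpt)
    _ = M ^ 2 * volume.real S := by rw [setIntegral_const, smul_eq_mul, mul_comm]

/-- The collar `[−b', b'] \ [−b, b]` has measure at most `2(b' − b)` (`b ≤ b'`). -/
theorem volume_real_collar_le (hbb : b ≤ b') :
    volume.real (Icc (-b') b' \ Icc (-b) b) ≤ 2 * (b' - b) := by
  have hsub : Icc (-b') b' \ Icc (-b) b ⊆ Icc (-b') (-b) ∪ Icc b b' := by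
    intro x hx
    rcases hx with ⟨hx1, hx2⟩
    by_cases hxl : x ≤ -b
    · exact Or.inl ⟨hx1.1, hxl⟩
    · refine Or.inr ⟨?_, hx1.2⟩
      by_contra hlt
      exact hx2 ⟨by linarith, by linarith⟩
  calc volume.real (Icc (-b') b' \ Icc (-b) b)
      ≤ volume.real (Icc (-b') (-b) ∪ Icc b b') :=
        measureReal_mono hsub (measure_union_lt_top measure_Icc_lt_top measure_Icc_lt_top).ne
    _ ≤ volume.real (Icc (-b') (-b)) + volume.real (Icc b b') := measureReal_union_le _ _
    _ = 2 * (b' - b) := by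
        rw [Real.volume_real_Icc_of_le (by linarith), Real.volume_real_Icc_of_le hbb]; ring

/-! ## §4 Cauchy–Schwarz against an admissible function -/

/-- **`|∫_S F v| ≤ √(∫_S F²)·√(∫ v²)`** for measurable bounded `F` with `F²` integrable on `S` and admissible `v` on `[−B, B]`. -/
theorem abs_setIntegral_mul_le {F v : ℝ → ℝ} {CF Cv B : ℝ} (hF : Measurable F) (hCF : ∀ x, |F x| ≤ CF)
    (hv : Measurable v) (hCv : ∀ x, |v x| ≤ Cv) (hvs : ∀ x, x ∉ Icc (-B) B → v x = 0)
    {S : Set ℝ} (hS : MeasurableSet S) (hF2 : IntegrableOn (fun x ↦ F x ^ 2) S) :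
    |∫ x in S, F x * v x| ≤ Real.sqrt (∫ x in S, F x ^ 2) * Real.sqrt (∫ x, v x ^ 2) := by
  have hCF0 : 0 ≤ CF := (abs_nonneg _).trans (hCF 0)
  set g : ℝ → ℝ := (S ∩ Icc (-B) B).indicator F with hg
  have hgm : Measurable g := hF.indicator (hS.inter measurableSet_Icc)
  have hgabs : ∀ x, |g x| ≤ CF := fun x ↦ by
    by_cases hx : x ∈ S ∩ Icc (-B) B
    · rw [hg, indicator_of_mem hx]; exact hCF x
    · rw [hg, indicator_of_notMem hx, abs_zero]; exact hCF0
  -- `g v = 1_S F v`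
  have hgv : ∀ x, g x * v x = S.indicator (fun y ↦ F y * v y) x := fun x ↦ by
    by_cases hxI : x ∈ Icc (-B) B
    · by_cases hxS : x ∈ S
      · rw [hg, indicator_of_mem (show x ∈ S ∩ Icc (-B) B from ⟨hxS, hxI⟩), indicator_of_mem hxS]
      · rw [hg, indicator_of_notMem fun h ↦ hxS h.1, indicator_of_notMem hxS, zero_mul]
    · rw [hvs x hxI, mul_zero]
      by_cases hxS : x ∈ S
      · rw [indicator_of_mem hxS, hvs x hxI, mul_zero]
      · rw [indicator_of_notMem hxS]
  have h1 : ∫ x in S, F x * v x = ∫ x, g x * v x := by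
    rw [← integral_indicator hS]
    exact integral_congr_ae (Eventually.of_forall fun x ↦ (hgv x).symm)
  -- integrability
  have hgg : Integrable fun x ↦ g x ^ 2 := by
    have e : (fun x ↦ g x ^ 2) = (S ∩ Icc (-B) B).indicator fun x ↦ F x ^ 2 := by
      funext x
      by_cases hx : x ∈ S ∩ Icc (-B) B
      · rw [hg, indicator_of_mem hx, indicator_of_mem hx]
      · rw [hg, indicator_of_notMem hx, indicator_of_notMem hx]; ring
    rw [e, integrable_indicator_iff (hS.inter measurableSet_Icc)]
    exact hF2.mono_set inter_subset_left
  have hgvI : Integrable fun x ↦ g x * v x := integrable_mul_admissible hgm hgabs hv hCv hvs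
  have hvv : Integrable fun x ↦ v x ^ 2 := integrable_sq_admissible hv hCv hvs
  have hCS := FloorSmoothing.sq_integral_mul_le hgg hgvI hvv
  -- `∫ g² ≤ ∫_S F²`
  have hg2 : ∫ x, g x ^ 2 ≤ ∫ x in S, F x ^ 2 := by
    have e : ∫ x, g x ^ 2 = ∫ x in S ∩ Icc (-B) B, F x ^ 2 := by
      rw [← integral_indicator (hS.inter measurableSet_Icc)]
      refine integral_congr_ae (Eventually.of_forall fun x ↦ ?_)
      by_cases hx : x ∈ S ∩ Icc (-B) B
      · simp only [hg, indicator_of_mem hx]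
      · simp only [hg, indicator_of_notMem hx]; ring
    rw [e]
    exact setIntegral_mono_set hF2 (Eventually.of_forall fun x ↦ sq_nonneg _)
      (Eventually.of_forall inter_subset_left)
  rw [h1]
  calc |∫ x, g x * v x| ≤ Real.sqrt ((∫ x, g x ^ 2) * ∫ x, v x ^ 2) := Real.abs_le_sqrt hCS
    _ = Real.sqrt (∫ x, g x ^ 2) * Real.sqrt (∫ x, v x ^ 2) :=
        Real.sqrt_mul (integral_nonneg fun x ↦ sq_nonneg _) _
    _ ≤ Real.sqrt (∫ x in S, F x ^ 2) * Real.sqrt (∫ x, v x ^ 2) :=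
        mul_le_mul_of_nonneg_right (Real.sqrt_le_sqrt hg2) (Real.sqrt_nonneg _)

/-! ## §5 The coupling transfer -/

/-- **COUPLING TRANSFER.**  `G` admissible on `[−b, b]` (the profile), `Gm` admissible on `[−b', b'] ⊇ [−b, b]` (its perturbation),
`r` admissible on `[−b', b']` with `∫ Gm·r = 0`; then for every real `τ`
`|∫ (T_{b'} Gm)·r| ≤ (√(∫_{(−b,b)} (T_b G − τG)²) + (2Σ_{b'}Λ/√n + |τ|)·√∫(Gm − G)² + 2(Σ_{b'}Λ/√n)·sup|G|·√(2(b'−b)))·√∫r²`. -/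
theorem abs_integral_primeShiftOp_mul_le {G Gm r : ℝ → ℝ} {CG CGm Cr : ℝ} (hbb : b ≤ b')
    (hG : Measurable G) (hCG : ∀ x, |G x| ≤ CG) (hGs : ∀ x, x ∉ Icc (-b) b → G x = 0)
    (hGm : Measurable Gm) (hCGm : ∀ x, |Gm x| ≤ CGm) (hGms : ∀ x, x ∉ Icc (-b') b' → Gm x = 0)
    (hr : Measurable r) (hCr : ∀ x, |r x| ≤ Cr) (hrs : ∀ x, x ∉ Icc (-b') b' → r x = 0)
    (horth : ∫ x, Gm x * r x = 0) (τ : ℝ) :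
    |∫ x, (∑ n ∈ weilPrimeIndex b', (Λ n : ℝ) / Real.sqrt n * (Gm (x - Real.log n) + Gm (x + Real.log n))) * r x|
      ≤ (Real.sqrt (∫ x in Ioo (-b) b,
            ((∑ n ∈ weilPrimeIndex b, (Λ n : ℝ) / Real.sqrt n * (G (x - Real.log n) + G (x + Real.log n))) - τ * G x) ^ 2)
          + (2 * (∑ n ∈ weilPrimeIndex b', (Λ n : ℝ) / Real.sqrt n) + |τ|) * Real.sqrt (∫ x, (Gm x - G x) ^ 2)
          + 2 * (∑ n ∈ weilPrimeIndex b', (Λ n : ℝ) / Real.sqrt n) * CG * Real.sqrt (2 * (b' - b)))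
        * Real.sqrt (∫ x, r x ^ 2) := by
  have hCG0 : 0 ≤ CG := (abs_nonneg _).trans (hCG 0)
  set A' := ∑ n ∈ weilPrimeIndex b', (Λ n : ℝ) / Real.sqrt n with hA'
  have hA'0 : 0 ≤ A' := Finset.sum_nonneg fun n _ ↦ div_nonneg ArithmeticFunction.vonMangoldt_nonneg (Real.sqrt_nonneg _)
  -- the difference `D = Gm − G`, admissible on `[−b', b']`
  set D : ℝ → ℝ := fun x ↦ Gm x - G x with hD
  have hDm : Measurable D := hGm.sub hG
  have hCD : ∀ x, |D x| ≤ CGm + CG := fun x ↦ (abs_sub _ _).trans (add_le_add (hCGm x) (hCG x))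
  have hGs' : ∀ x, x ∉ Icc (-b') b' → G x = 0 := fun x hx ↦ hGs x fun hm ↦ hx ⟨by linarith [hm.1], by linarith [hm.2]⟩
  have hDs : ∀ x, x ∉ Icc (-b') b' → D x = 0 := fun x hx ↦ by simp only [hD, hGms x hx, hGs' x hx, sub_zero]
  -- the operators
  set TGm : ℝ → ℝ := fun x ↦ ∑ n ∈ weilPrimeIndex b', (Λ n : ℝ) / Real.sqrt n * (Gm (x - Real.log n) + Gm (x + Real.log n))
    with hTGm
  set TD : ℝ → ℝ := fun x ↦ ∑ n ∈ weilPrimeIndex b', (Λ n : ℝ) / Real.sqrt n * (D (x - Real.log n) + D (x + Real.log n))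
    with hTD
  set TG' : ℝ → ℝ := fun x ↦ ∑ n ∈ weilPrimeIndex b', (Λ n : ℝ) / Real.sqrt n * (G (x - Real.log n) + G (x + Real.log n))
    with hTG'
  set TG : ℝ → ℝ := fun x ↦ ∑ n ∈ weilPrimeIndex b, (Λ n : ℝ) / Real.sqrt n * (G (x - Real.log n) + G (x + Real.log n))
    with hTG
  have mTD : Measurable TD := measurable_primeShiftOp hDm
  have mTG' : Measurable TG' := measurable_primeShiftOp hG
  have mTG : Measurable TG := measurable_primeShiftOp hG
  have bTD : ∀ x, |TD x| ≤ 2 * A' * (CGm + CG) := fun x ↦ abs_primeShiftOp_le hCD x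
  have bTG' : ∀ x, |TG' x| ≤ 2 * A' * CG := fun x ↦ abs_primeShiftOp_le hCG x
  have bTG : ∀ x, |TG x - τ * G x| ≤ 2 * (∑ n ∈ weilPrimeIndex b, (Λ n : ℝ) / Real.sqrt n) * CG + |τ| * CG := fun x ↦ by
    refine (abs_sub _ _).trans (add_le_add (abs_primeShiftOp_le hCG x) ?_)
    rw [abs_mul]; exact mul_le_mul_of_nonneg_left (hCG x) (abs_nonneg _)
  -- (1) `∫ TGm r = ∫ TD r + ∫ TG' r`
  have hpt : ∀ x, TGm x * r x = TD x * r x + TG' x * r x := fun x ↦ by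
    simp only [hTGm, hTD, hTG', hD, ← add_mul, ← Finset.sum_add_distrib]
    exact congrArg (· * r x) (Finset.sum_congr rfl fun n _ ↦ by ring)
  have iTDr : Integrable fun x ↦ TD x * r x := integrable_mul_admissible mTD bTD hr hCr hrs
  have iTG'r : Integrable fun x ↦ TG' x * r x := integrable_mul_admissible mTG' bTG' hr hCr hrs
  have h1 : ∫ x, TGm x * r x = (∫ x, TD x * r x) + ∫ x, TG' x * r x := by
    rw [← integral_add iTDr iTG'r]; exact integral_congr_ae (Eventually.of_forall hpt)
  -- (2) `∫ TG' r = ∫ (TG' − τG) r − τ ∫ D r` (using `∫ Gm r = 0`)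
  have iGr : Integrable fun x ↦ G x * r x := integrable_mul_admissible hG hCG hr hCr hrs
  have iDr : Integrable fun x ↦ D x * r x := integrable_mul_admissible hDm hCD hr hCr hrs
  have iFr : Integrable fun x ↦ (TG' x - τ * G x) * r x := by
    have := iTG'r.sub (iGr.const_mul τ)
    exact this.congr (Eventually.of_forall fun x ↦ by simp only [Pi.sub_apply]; ring)
  have hGr : ∫ x, G x * r x = -∫ x, D x * r x := by
    have e : (fun x ↦ G x * r x) = fun x ↦ Gm x * r x - D x * r x := funext fun x ↦ by simp only [hD]; ring
    rw [e, integral_sub (integrable_mul_admissible hGm hCGm hr hCr hrs) iDr, horth, zero_sub]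
  have h2 : ∫ x, TG' x * r x = (∫ x, (TG' x - τ * G x) * r x) - τ * ∫ x, D x * r x := by
    have e : (fun x ↦ TG' x * r x) = fun x ↦ (TG' x - τ * G x) * r x + τ * (G x * r x) := funext fun x ↦ by ring
    rw [e, integral_add iFr (iGr.const_mul τ), integral_const_mul, hGr]; ring
  -- (3) `∫ (TG' − τG) r = ∫_{(−b,b)} (TG − τG) r + ∫_{collar} TG' r`
  have hcollar : MeasurableSet (Icc (-b') b' \ Icc (-b) b) := measurableSet_Icc.diff measurableSet_Icc
  have h3 : ∫ x, (TG' x - τ * G x) * r x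
      = (∫ x in Ioo (-b) b, (TG x - τ * G x) * r x) + ∫ x in Icc (-b') b' \ Icc (-b) b, TG' x * r x := by
    rw [← setIntegral_eq_integral_of_forall_compl_eq_zero (s := Icc (-b') b')
      (fun x hx ↦ by rw [hrs x hx, mul_zero])]
    have hsplit := setIntegral_sdiff (μ := volume) (f := fun x ↦ (TG' x - τ * G x) * r x) measurableSet_Icc
      iFr.integrableOn (Icc_subset_Icc (by linarith) hbb : Icc (-b) b ⊆ Icc (-b') b')
    have hin : ∫ x in Icc (-b) b, (TG' x - τ * G x) * r x = ∫ x in Ioo (-b) b, (TG x - τ * G x) * r x := by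
      rw [integral_Icc_eq_integral_Ioo]
      refine setIntegral_congr_fun measurableSet_Ioo fun x hx ↦ ?_
      simp only [hTG', hTG]
      rw [primeShiftOp_eq_of_le hGs hbb hx]
    have hout : ∫ x in Icc (-b') b' \ Icc (-b) b, (TG' x - τ * G x) * r x
        = ∫ x in Icc (-b') b' \ Icc (-b) b, TG' x * r x :=
      setIntegral_congr_fun hcollar fun x hx ↦ by simp only [hGs x hx.2, mul_zero, sub_zero]
    rw [← hin, ← hout]; linarith [hsplit]
  -- (4) the four Cauchy–Schwarz bounds
  set sR := Real.sqrt (∫ x, r x ^ 2) with hsR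
  have hsR0 : 0 ≤ sR := Real.sqrt_nonneg _
  have iD2 : Integrable fun x ↦ D x ^ 2 := integrable_sq_admissible hDm hCD hDs
  have B1 : |∫ x, TD x * r x| ≤ 2 * A' * Real.sqrt (∫ x, D x ^ 2) * sR := by
    have h := abs_setIntegral_mul_le mTD bTD hr hCr hrs MeasurableSet.univ
      (integrable_primeShiftOp_sq hDm hCD hDs).integrableOn
    rw [Measure.restrict_univ] at h
    refine h.trans (mul_le_mul_of_nonneg_right ?_ hsR0)
    calc Real.sqrt (∫ x, TD x ^ 2) ≤ Real.sqrt (4 * A' ^ 2 * ∫ x, D x ^ 2) :=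
          Real.sqrt_le_sqrt (integral_primeShiftOp_sq_le hDm hCD hDs)
      _ = 2 * A' * Real.sqrt (∫ x, D x ^ 2) := by
          rw [show 4 * A' ^ 2 * ∫ x, D x ^ 2 = (2 * A') ^ 2 * ∫ x, D x ^ 2 by ring,
            Real.sqrt_mul (sq_nonneg _), Real.sqrt_sq (by positivity)]
  have B2 : |∫ x in Ioo (-b) b, (TG x - τ * G x) * r x| ≤ Real.sqrt (∫ x in Ioo (-b) b, (TG x - τ * G x) ^ 2) * sR := by
    refine abs_setIntegral_mul_le (mTG.sub (measurable_const.mul hG)) bTG hr hCr hrs measurableSet_Ioo ?_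
    refine Measure.integrableOn_of_bounded measure_Ioo_lt_top.ne
      (((mTG.sub (measurable_const.mul hG)).pow_const 2).aestronglyMeasurable)
      (M := (2 * (∑ n ∈ weilPrimeIndex b, (Λ n : ℝ) / Real.sqrt n) * CG + |τ| * CG) ^ 2)
      (Eventually.of_forall fun x ↦ ?_)
    rw [Real.norm_eq_abs, abs_of_nonneg (sq_nonneg _), ← sq_abs]
    exact pow_le_pow_left₀ (abs_nonneg _) (bTG x) 2
  have B3 : |∫ x in Icc (-b') b' \ Icc (-b) b, TG' x * r x| ≤ 2 * A' * CG * Real.sqrt (2 * (b' - b)) * sR := by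
    have hfin : volume (Icc (-b') b' \ Icc (-b) b) ≠ ⊤ := (measure_mono sdiff_subset |>.trans_lt measure_Icc_lt_top).ne
    have h := abs_setIntegral_mul_le mTG' bTG' hr hCr hrs hcollar
      ((integrable_primeShiftOp_sq hG hCG hGs).integrableOn)
    refine h.trans (mul_le_mul_of_nonneg_right ?_ hsR0)
    calc Real.sqrt (∫ x in Icc (-b') b' \ Icc (-b) b, TG' x ^ 2)
        ≤ Real.sqrt ((2 * A' * CG) ^ 2 * (2 * (b' - b))) :=
          Real.sqrt_le_sqrt ((setIntegral_primeShiftOp_sq_le hCG hfin).trans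
            (mul_le_mul_of_nonneg_left (volume_real_collar_le hbb) (sq_nonneg _)))
      _ = 2 * A' * CG * Real.sqrt (2 * (b' - b)) := by
          rw [Real.sqrt_mul (sq_nonneg _), Real.sqrt_sq (by positivity)]
  have B4 : |∫ x, D x * r x| ≤ Real.sqrt (∫ x, D x ^ 2) * sR := by
    have h := abs_setIntegral_mul_le hDm hCD hr hCr hrs MeasurableSet.univ iD2.integrableOn
    rwa [Measure.restrict_univ] at h
  -- (5) assemble
  have key : |∫ x, TGm x * r x|
      ≤ (Real.sqrt (∫ x in Ioo (-b) b, (TG x - τ * G x) ^ 2) + (2 * A' + |τ|) * Real.sqrt (∫ x, D x ^ 2)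
          + 2 * A' * CG * Real.sqrt (2 * (b' - b))) * sR := by
    rw [h1, h2, h3]
    have hτ : |τ * ∫ x, D x * r x| ≤ |τ| * (Real.sqrt (∫ x, D x ^ 2) * sR) := by
      rw [abs_mul]; exact mul_le_mul_of_nonneg_left B4 (abs_nonneg τ)
    have tri : ∀ x y z w : ℝ, |x + (y + z - w)| ≤ |x| + (|y| + |z| + |w|) := fun x y z w ↦ by
      linarith [abs_add_le x (y + z - w), abs_sub (y + z) w, abs_add_le y z]
    refine (tri _ _ _ _).trans ?_
    linarith [B1, B2, B3, hτ]
  simpa only [hTGm, hTG, hD] using key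

end FloorCoshSplit

end Summit.RiemannHypothesis.RiemannHypothesis.Theorems.WeilFormatC
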